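import Literature.Geometry.GeometricMeasureTheory.PushforwardRectifiable
import Literature.Geometry.GeometricMeasureTheory.HausdorffDensity
import Literature.MeasureTheory.Hausdorff.SphericalCap
import Mathlib.Analysis.LocallyConvex.SeparatingDual
import HarnessLib

/-!
# Currents of integration under a linear isomorphism: tangent cones and the change of variables

For a continuous linear isomorphism `L : V ≃L[ℝ] V'` of finite-dimensional real normed (resp. inner
product) spaces we prove the two facts about rectifiable currents of integration `[W, θ, ξ]`
(`Currents.lean`, Federer 4.1.28) that make `L_# [W, θ, ξ] = [L W, θ ∘ L⁻¹, ξ']` for the correctly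
oriented unit frame `ξ'` of `L(Tan^m)`:

* §1 (any real normed spaces) **`posTangentConeAt_image_equiv`** — `Tan(L S, L x) = L Tan(S, x)`
  (Federer's tangent cone 3.1.21 = Mathlib's `posTangentConeAt`; a continuous linear map maps
  `Tan(S, x)` into `Tan(A S, A x)`, `image_posTangentConeAt_subset`); the comparison of upper densities
  `upperDensity_eq_zero_of_closedBall_le` (`Θ^{*m}(μ', x') = 0` as soon as
  `μ'(𝐁(x', ρ)) ≤ K μ(𝐁(x, cρ))` and `Θ^{*m}(μ, x) = 0`, Federer 2.10.19); and
  **`approxTangentCone_image_equiv`** —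
  `Tan^m(𝓗^m ⌞ L W, L x) = L Tan^m(𝓗^m ⌞ W, x)` for `W` measurable (Federer 3.2.16: `L` is
  bi-Lipschitz, so the densities `Θ^{*m}(𝓗^m ⌞ W ⌞ Sᶜ, x)` and `Θ^{*m}(𝓗^m ⌞ L W ⌞ (L S)ᶜ, L x)` vanish
  together, and the tangent cones correspond).
* §2 (finite-dimensional real inner product spaces) **`setIntegral_image_equiv_eq`** — the CHANGE OF
  VARIABLES FOR CURRENTS OF INTEGRATION: if `(W, θ, ξ)` are admissible rectifiable data
  (`IsRectifiableData`), `θ'`, `ξ'` are a density and a unit frame field on `V'` with `θ' ∘ L = θ` and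
  `L ξ₁ ∧ ⋯ ∧ L ξₘ = c(x) · ξ'₁(Lx) ∧ ⋯ ∧ ξ'ₘ(Lx)` with `c(x) > 0` for `𝓗^m ⌞ W`-a.e. `x` (the frame
  `ξ'` orients `L(Tan^m)` compatibly with `L_* ξ`), then for every measurable `A ⊆ W` and every field of
  `F`-valued `m`-covectors `ψ` on `V'`
  `∫_{L A} θ' ψ(ξ') d𝓗^m = ∫_A θ (ψ ∘ L)(L ξ₁, …, L ξₘ) d𝓗^m`
  (Federer 4.1.30 / 3.2.5 / 3.2.20: decompose `W` into the bi-Lipschitz pieces `gⱼ(Eⱼ)` of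
  `RectifiablePieces.lean`, apply the area formula `AreaFormulaHausdorff.lean` to `gⱼ` and to `L ∘ gⱼ`,
  and compare the Jacobians: `J(L ∘ Dgⱼ) = c · J(Dgⱼ)`, `normDet_comp_eq_mul_of_frameVector_eq`;
  `apply_eq_smul_of_frameVector_eq` transports the orientation factor to `F`-valued covectors).

Theorems only; no definition, no named fact.

## References

* H. Federer, *Geometric Measure Theory*, Springer 1969, 2.10.19, 3.1.21, 3.2.5, 3.2.16, 3.2.18–3.2.20,
  4.1.28, 4.1.30 [Federer1969].
-/

noncomputable section

open scoped InnerProductSpace ENNReal NNReal Topology Pointwise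
open MeasureTheory MeasureTheory.Measure Set Function Filter Metric Module TopologicalSpace
open Literature.Analysis.Calculus

namespace Literature.Geometry.GeometricMeasureTheory

-- Nested operator-norm instances on (duals of) `V [⋀^Fin n]→L[ℝ] ℝ`.
set_option maxSynthPendingDepth 2

/-! ### §1 Tangent cones, densities and approximate tangent cones under a linear isomorphism -/

section TangentCone

variable {V : Type*} [NormedAddCommGroup V] [NormedSpace ℝ V]
  {V' : Type*} [NormedAddCommGroup V'] [NormedSpace ℝ V']

/-- A continuous linear map `A` maps `Tan(S, x)` into `Tan(A S, A x)` (Federer's tangent cone 3.1.21,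
Mathlib's `posTangentConeAt`: limits of `cₙ • (xₙ - x)`, `cₙ ≥ 0`). [cite: Federer1969, 3.1.21] -/
theorem image_posTangentConeAt_subset (A : V →L[ℝ] V') (s : Set V) (x : V) :
    A '' posTangentConeAt s x ⊆ posTangentConeAt (A '' s) (A x) := by
  rintro _ ⟨v, hv, rfl⟩
  rw [mem_tangentConeAt_iff_exists_seq] at hv ⊢
  obtain ⟨c, d, hd0, hds, hcd⟩ := hv
  refine ⟨c, fun n => A (d n), ?_, ?_, ?_⟩
  · have h := (A.continuous.tendsto 0).comp hd0
    rw [map_zero] at h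
    exact h
  · filter_upwards [hds] with n hn
    exact ⟨x + d n, hn, by rw [map_add]⟩
  · have e : (fun n => c n • A (d n)) = fun n => A (c n • d n) := by
      funext n
      rw [NNReal.smul_def, NNReal.smul_def, map_smul]
    rw [e]
    exact (A.continuous.tendsto v).comp hcd

/-- **`Tan(L S, L x) = L Tan(S, x)`** for a continuous linear isomorphism `L`.
[cite: Federer1969, 3.1.21] -/
theorem posTangentConeAt_image_equiv (L : V ≃L[ℝ] V') (s : Set V) (x : V) :
    posTangentConeAt (L '' s) (L x) = L '' posTangentConeAt s x := by
  refine Subset.antisymm (fun v hv => ?_) (image_posTangentConeAt_subset (L : V →L[ℝ] V') s x)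
  have h := image_posTangentConeAt_subset (L.symm : V' →L[ℝ] V) (L '' s) (L x) ⟨v, hv, rfl⟩
  have h1 : (L.symm : V' →L[ℝ] V) '' ((L : V → V') '' s) = s := by
    rw [Set.image_image]
    simp
  have h2 : (L.symm : V' →L[ℝ] V) (L x) = x := L.symm_apply_apply x
  rw [h1, h2] at h
  exact ⟨L.symm v, h, L.apply_symm_apply v⟩

/-- Preimage form: `Tan(L⁻¹ S, x) = L⁻¹ Tan(S, L x)`. [cite: Federer1969, 3.1.21] -/
theorem posTangentConeAt_preimage_equiv (L : V ≃L[ℝ] V') (s : Set V') (x : V) :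
    posTangentConeAt (L ⁻¹' s) x = L ⁻¹' posTangentConeAt s (L x) := by
  have h := posTangentConeAt_image_equiv L (L ⁻¹' s) x
  rw [Set.image_preimage_eq s L.surjective] at h
  rw [h, Set.preimage_image_eq _ L.injective]

variable [MeasurableSpace V] [MeasurableSpace V'] {m : ℕ}

omit [NormedSpace ℝ V] [NormedSpace ℝ V'] in
/-- **Comparison of upper densities** (Federer 2.10.19): if `μ'(𝐁(x', ρ)) ≤ K · μ(𝐁(x, c ρ))` for all
`ρ > 0` (`K < ∞`, `c > 0`) and `Θ^{*m}(μ, x) = 0`, then `Θ^{*m}(μ', x') = 0`. [cite: Federer1969, 2.10.19] -/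
theorem upperDensity_eq_zero_of_closedBall_le {μ : Measure V} {μ' : Measure V'} {x : V} {x' : V'}
    {K : ℝ≥0∞} (hK : K ≠ ⊤) {c : ℝ} (hc : 0 < c)
    (h : ∀ ρ : ℝ, 0 < ρ → μ' (closedBall x' ρ) ≤ K * μ (closedBall x (c * ρ)))
    (h0 : upperDensity m μ x = 0) : upperDensity m μ' x' = 0 := by
  have ht := tendsto_of_upperDensity_eq_zero (m := m) h0
  -- `ρ ↦ c ρ` preserves `𝓝[>] 0`
  have hmap : Tendsto (fun ρ : ℝ => c * ρ) (𝓝[>] (0 : ℝ)) (𝓝[>] (0 : ℝ)) := by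
    refine tendsto_nhdsWithin_of_tendsto_nhds_of_eventually_within _ ?_ ?_
    · have : Tendsto (fun ρ : ℝ => c * ρ) (𝓝 (0 : ℝ)) (𝓝 (c * 0)) :=
        (continuous_const.mul continuous_id).tendsto 0
      rw [mul_zero] at this
      exact this.mono_left nhdsWithin_le_nhds
    · filter_upwards [self_mem_nhdsWithin] with ρ hρ
      exact mul_pos hc hρ
  have hg : Tendsto (fun ρ : ℝ => μ (closedBall x (c * ρ)) /
      (unitBallVolume m * ENNReal.ofReal ((c * ρ) ^ m))) (𝓝[>] (0 : ℝ)) (𝓝 0) := ht.comp hmap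
  set C : ℝ≥0∞ := K * ENNReal.ofReal (c ^ m) with hC
  have hCtop : C ≠ ⊤ := ENNReal.mul_ne_top hK ENNReal.ofReal_ne_top
  have hbound : ∀ᶠ ρ in 𝓝[>] (0 : ℝ), μ' (closedBall x' ρ) / (unitBallVolume m * ENNReal.ofReal (ρ ^ m)) ≤
      C * (μ (closedBall x (c * ρ)) / (unitBallVolume m * ENNReal.ofReal ((c * ρ) ^ m))) := by
    filter_upwards [self_mem_nhdsWithin] with ρ hρ
    have hρ' : (0 : ℝ) < ρ := hρ
    have hcm : ENNReal.ofReal (c ^ m) ≠ 0 := (ENNReal.ofReal_pos.2 (pow_pos hc m)).ne'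
    calc μ' (closedBall x' ρ) / (unitBallVolume m * ENNReal.ofReal (ρ ^ m))
        ≤ (K * μ (closedBall x (c * ρ))) / (unitBallVolume m * ENNReal.ofReal (ρ ^ m)) := by
          gcongr
          exact h ρ hρ'
      _ = C * (μ (closedBall x (c * ρ)) / (unitBallVolume m * ENNReal.ofReal ((c * ρ) ^ m))) := by
          rw [hC, mul_pow, ENNReal.ofReal_mul (pow_nonneg hc.le _), mul_left_comm (unitBallVolume m),
            mul_assoc K, ← mul_div_assoc (ENNReal.ofReal (c ^ m)),
            ENNReal.mul_div_mul_left _ _ hcm ENNReal.ofReal_ne_top, mul_div_assoc]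
  have hlim : Tendsto (fun ρ : ℝ => C * (μ (closedBall x (c * ρ)) /
      (unitBallVolume m * ENNReal.ofReal ((c * ρ) ^ m)))) (𝓝[>] (0 : ℝ)) (𝓝 0) := by
    have := ENNReal.Tendsto.const_mul hg (Or.inr hCtop)
    rwa [mul_zero] at this
  have hzero : Tendsto (fun ρ : ℝ => μ' (closedBall x' ρ) / (unitBallVolume m * ENNReal.ofReal (ρ ^ m)))
      (𝓝[>] (0 : ℝ)) (𝓝 0) :=
    tendsto_of_tendsto_of_tendsto_of_le_of_le' tendsto_const_nhds hlim
      (Eventually.of_forall fun _ => zero_le) hbound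
  exact hzero.limsup_eq

variable [BorelSpace V] [BorelSpace V']

omit [MeasurableSpace V] [MeasurableSpace V'] [BorelSpace V] [BorelSpace V'] in
/-- A continuous linear isomorphism maps closed balls into closed balls:
`L (𝐁(x, ρ)) ⊆ 𝐁(L x, ‖L‖ ρ)` — written with `max ‖L‖ 1` to keep the radius positive. [folklore] -/
private theorem image_closedBall_subset_closedBall_equiv (L : V ≃L[ℝ] V') (x : V) (ρ : ℝ) :
    (L : V → V') '' closedBall x ρ ⊆ closedBall (L x) (max ‖(L : V →L[ℝ] V')‖ 1 * ρ) := by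
  rintro _ ⟨y, hy, rfl⟩
  rw [mem_closedBall, dist_eq_norm] at hy ⊢
  calc ‖L y - L x‖ = ‖(L : V →L[ℝ] V') (y - x)‖ := by simp [map_sub]
    _ ≤ ‖(L : V →L[ℝ] V')‖ * ‖y - x‖ := (L : V →L[ℝ] V').le_opNorm _
    _ ≤ max ‖(L : V →L[ℝ] V')‖ 1 * ρ := by
        gcongr
        · exact le_max_left _ _

/-- **Densities of `𝓗^m ⌞ L W ⌞ (L S)ᶜ` at `L x` and of `𝓗^m ⌞ W ⌞ Sᶜ` at `x` vanish together** (`L` is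
bi-Lipschitz: `𝓗^m(L B) ≤ ‖L‖ᵐ 𝓗^m(B)` and `L⁻¹ 𝐁(Lx, ρ) ⊆ 𝐁(x, ‖L⁻¹‖ρ)`). [cite: Federer1969, 2.10.19] -/
theorem upperDensity_restrict_image_eq_zero_iff (L : V ≃L[ℝ] V') {W : Set V} (hW : MeasurableSet W)
    (S : Set V) (x : V) :
    upperDensity m ((((μHE[m] : Measure V').restrict ((L : V → V') '' W))).restrict
        ((L : V → V') '' S)ᶜ) (L x) = 0 ↔
      upperDensity m (((μHE[m] : Measure V).restrict W).restrict Sᶜ) x = 0 := by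
  have hLW : MeasurableSet ((L : V → V') '' W) :=
    L.toHomeomorph.measurableEmbedding.measurableSet_image.2 hW
  -- the measures of balls, rewritten
  have hV' : ∀ ρ : ℝ, (((μHE[m] : Measure V').restrict ((L : V → V') '' W)).restrict
      ((L : V → V') '' S)ᶜ) (closedBall (L x) ρ) =
        (μHE[m] : Measure V') ((L : V → V') '' ((L : V → V') ⁻¹' closedBall (L x) ρ ∩ Sᶜ ∩ W)) := by
    intro ρ
    have hset : closedBall (L x) ρ ∩ ((L : V → V') '' S)ᶜ ∩ (L : V → V') '' W =
        (L : V → V') '' ((L : V → V') ⁻¹' closedBall (L x) ρ ∩ Sᶜ ∩ W) := by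
      rw [Set.image_inter L.injective, Set.image_inter L.injective, Set.image_preimage_eq _ L.surjective,
        Set.image_compl_eq L.bijective]
    rw [Measure.restrict_apply measurableSet_closedBall, Measure.restrict_apply' hLW, hset]
  have hV : ∀ ρ : ℝ, (((μHE[m] : Measure V).restrict W).restrict Sᶜ) (closedBall x ρ) =
      (μHE[m] : Measure V) (closedBall x ρ ∩ Sᶜ ∩ W) := by
    intro ρ
    rw [Measure.restrict_apply measurableSet_closedBall, Measure.restrict_apply' hW]
  constructor
  · intro h0
    -- compare `μ = 𝓗 ⌞ W ⌞ Sᶜ` at `x` with `μ' = 𝓗 ⌞ L W ⌞ (L S)ᶜ` at `L x`, via `L`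
    refine upperDensity_eq_zero_of_closedBall_le (K := (‖(L.symm : V' →L[ℝ] V)‖₊ : ℝ≥0∞) ^ m)
      (ENNReal.pow_ne_top ENNReal.coe_ne_top) (c := max ‖(L : V →L[ℝ] V')‖ 1)
      (lt_of_lt_of_le zero_lt_one (le_max_right _ _)) (fun ρ hρ => ?_) h0
    rw [hV, hV']
    -- `𝐁(x,ρ) ∩ Sᶜ ∩ W = L⁻¹ (L(𝐁(x,ρ) ∩ Sᶜ ∩ W))` and `L(𝐁(x,ρ)) ⊆ 𝐁(Lx, cρ)`
    have hsub : closedBall x ρ ∩ Sᶜ ∩ W =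
        (L.symm : V' → V) '' ((L : V → V') '' (closedBall x ρ ∩ Sᶜ ∩ W)) := by
      rw [Set.image_image]
      simp
    calc (μHE[m] : Measure V) (closedBall x ρ ∩ Sᶜ ∩ W)
        = (μHE[m] : Measure V) ((L.symm : V' → V) '' ((L : V → V') '' (closedBall x ρ ∩ Sᶜ ∩ W))) := by
          rw [← hsub]
      _ ≤ (‖(L.symm : V' →L[ℝ] V)‖₊ : ℝ≥0∞) ^ m *
          (μHE[m] : Measure V') ((L : V → V') '' (closedBall x ρ ∩ Sᶜ ∩ W)) :=
          ((L.symm : V' →L[ℝ] V).lipschitz.lipschitzOnWith).euclideanHausdorffMeasure_image_le m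
      _ ≤ (‖(L.symm : V' →L[ℝ] V)‖₊ : ℝ≥0∞) ^ m *
          (μHE[m] : Measure V') ((L : V → V') '' ((L : V → V') ⁻¹' closedBall (L x)
            (max ‖(L : V →L[ℝ] V')‖ 1 * ρ) ∩ Sᶜ ∩ W)) := by
          gcongr
          intro y hy
          exact image_closedBall_subset_closedBall_equiv L x ρ ⟨y, hy, rfl⟩
  · intro h0
    refine upperDensity_eq_zero_of_closedBall_le (K := (‖(L : V →L[ℝ] V')‖₊ : ℝ≥0∞) ^ m)
      (ENNReal.pow_ne_top ENNReal.coe_ne_top) (c := max ‖(L.symm : V' →L[ℝ] V)‖ 1)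
      (lt_of_lt_of_le zero_lt_one (le_max_right _ _)) (fun ρ hρ => ?_) h0
    rw [hV, hV']
    calc (μHE[m] : Measure V') ((L : V → V') '' ((L : V → V') ⁻¹' closedBall (L x) ρ ∩ Sᶜ ∩ W))
        ≤ (‖(L : V →L[ℝ] V')‖₊ : ℝ≥0∞) ^ m *
          (μHE[m] : Measure V) ((L : V → V') ⁻¹' closedBall (L x) ρ ∩ Sᶜ ∩ W) :=
          ((L : V →L[ℝ] V').lipschitz.lipschitzOnWith).euclideanHausdorffMeasure_image_le m
      _ ≤ (‖(L : V →L[ℝ] V')‖₊ : ℝ≥0∞) ^ m *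
          (μHE[m] : Measure V) (closedBall x (max ‖(L.symm : V' →L[ℝ] V)‖ 1 * ρ) ∩ Sᶜ ∩ W) := by
          gcongr
          intro y hy
          have hy' : (L.symm : V' → V) (L y) ∈ (L.symm : V' → V) '' closedBall (L x) ρ := ⟨L y, hy, rfl⟩
          rw [L.symm_apply_apply] at hy'
          have := image_closedBall_subset_closedBall_equiv L.symm (L x) ρ hy'
          rwa [L.symm_apply_apply] at this

/-- **`Tan^m(𝓗^m ⌞ L W, L x) = L Tan^m(𝓗^m ⌞ W, x)`** for a continuous linear isomorphism `L` and `W`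
measurable: approximate tangent cones (Federer 3.2.16) are equivariant under bi-Lipschitz linear maps —
the admissible sets `S` (`Θ^{*m}(· ⌞ Sᶜ) = 0`) correspond under `S ↦ L S`
(`upperDensity_restrict_image_eq_zero_iff`) and so do the tangent cones (`posTangentConeAt_image_equiv`).
[cite: Federer1969, 3.2.16] -/
theorem approxTangentCone_image_equiv (L : V ≃L[ℝ] V') {W : Set V} (hW : MeasurableSet W) (x : V) :
    approxTangentCone m ((μHE[m] : Measure V').restrict ((L : V → V') '' W)) (L x) =
      (L : V → V') '' approxTangentCone m ((μHE[m] : Measure V).restrict W) x := by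
  ext v
  simp only [approxTangentCone, mem_iInter]
  constructor
  · intro hv
    refine ⟨L.symm v, ?_, L.apply_symm_apply v⟩
    simp only [mem_iInter]
    intro S hS
    have h1 := hv ((L : V → V') '' S) ((upperDensity_restrict_image_eq_zero_iff L hW S x).2 hS)
    rw [posTangentConeAt_image_equiv] at h1
    obtain ⟨w, hw, hwv⟩ := h1
    rw [← hwv, L.symm_apply_apply]
    exact hw
  · rintro ⟨w, hw, rfl⟩ S hS
    simp only [mem_iInter] at hw
    have hS' : upperDensity m (((μHE[m] : Measure V).restrict W).restrict ((L : V → V') ⁻¹' S)ᶜ) x = 0 := by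
      rw [← upperDensity_restrict_image_eq_zero_iff L hW, Set.image_preimage_eq S L.surjective]
      exact hS
    have h1 := hw _ hS'
    rw [posTangentConeAt_preimage_equiv] at h1
    exact h1

/-- Preimage form: **`Tan^m(𝓗^m ⌞ L⁻¹ W, x) = L⁻¹ Tan^m(𝓗^m ⌞ W, L x)`** for `W ⊆ V'` measurable.
[cite: Federer1969, 3.2.16] -/
theorem approxTangentCone_preimage_equiv (L : V ≃L[ℝ] V') {W : Set V'} (hW : MeasurableSet W) (x : V) :
    approxTangentCone m ((μHE[m] : Measure V).restrict ((L : V → V') ⁻¹' W)) x =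
      (L : V → V') ⁻¹' approxTangentCone m ((μHE[m] : Measure V').restrict W) (L x) := by
  have hW' : MeasurableSet ((L : V → V') ⁻¹' W) := hW.preimage L.continuous.measurable
  have h := approxTangentCone_image_equiv (m := m) L hW' x
  rw [Set.image_preimage_eq W L.surjective] at h
  rw [h, Set.preimage_image_eq _ L.injective]

end TangentCone

/-! ### §2 The change of variables for currents of integration under a linear isomorphism -/

section Frames

variable {V : Type*} [NormedAddCommGroup V] [InnerProductSpace ℝ V]
  {V' : Type*} [NormedAddCommGroup V'] [InnerProductSpace ℝ V'] {m : ℕ}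

/-- If `v₁ ∧ ⋯ ∧ vₘ = c · w₁ ∧ ⋯ ∧ wₘ` as functionals on real `m`-covectors, then `ω(v) = c • ω(w)` for
every `m`-covector `ω` with values in a real normed space (test against the dual of `F`; the duality
`⋀_m V ⊗ F = Hom(⋀^m V, F)`). [cite: Federer1969, 1.4.1] -/
theorem apply_eq_smul_of_frameVector_eq {F : Type*} [NormedAddCommGroup F] [NormedSpace ℝ F]
    {v w : Fin m → V'} {c : ℝ} (h : frameVector v = c • frameVector w)
    (ω : V' [⋀^Fin m]→L[ℝ] F) : ω v = c • ω w := by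
  refine (SeparatingDual.eq_iff_forall_dual_eq (R := ℝ)).2 fun ℓ => ?_
  have := congrArg (fun η : Multivector V' m => η (ℓ.compContinuousAlternatingMap ω)) h
  simp only [frameVector_apply, ContinuousLinearMap.compContinuousAlternatingMap_coe, Function.comp_apply,
    _root_.smul_apply, smul_eq_mul] at this
  rw [this, map_smul, smul_eq_mul]

/-- **Jacobians compose with the orientation factor.** Let `D : P → V` be an injective linear map whose
image is spanned by the orthonormal frame `ξ₀`, `L : V ≃ V'` a linear isomorphism and `ξ₁` an orthonormal
frame of `V'` with `L ξ₀,₁ ∧ ⋯ ∧ L ξ₀,ₘ = c · ξ₁,₁ ∧ ⋯ ∧ ξ₁,ₘ`, `c > 0`. Then `J(L ∘ D) = c · J(D)`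
(`J = normDet`: `ξ₀ = ± J(D)⁻¹ D e`, so `‖L_* ξ₀‖ = J(D)⁻¹ J(L ∘ D)`, while `‖L_* ξ₀‖ = c ‖ξ₁‖ = c`).
[cite: Federer1969, 3.2.1, 3.2.20] -/
theorem normDet_comp_eq_mul_of_frameVector_eq {P : Type*} [NormedAddCommGroup P] [InnerProductSpace ℝ P]
    [FiniteDimensional ℝ P] (e : OrthonormalBasis (Fin m) ℝ P) {D : P →L[ℝ] V} (hD : Injective D)
    {ξ₀ : Fin m → V} (h0 : Orthonormal ℝ ξ₀)
    (hspan : (Submodule.span ℝ (range ξ₀) : Set V) = range D)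
    (L : V ≃L[ℝ] V') {ξ₁ : Fin m → V'} (h1 : Orthonormal ℝ ξ₁) {c : ℝ} (hc : 0 < c)
    (hfv : frameVector (fun i => L (ξ₀ i)) = c • frameVector ξ₁) :
    ((((L : V →L[ℝ] V').comp D : P →L[ℝ] V') : P →ₗ[ℝ] V')).normDet = c * (D : P →ₗ[ℝ] V).normDet := by
  set Jg : ℝ := (D : P →ₗ[ℝ] V).normDet with hJg
  set JF : ℝ := ((((L : V →L[ℝ] V').comp D : P →L[ℝ] V') : P →ₗ[ℝ] V')).normDet with hJF
  have hJg0 : Jg ≠ 0 := by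
    rw [hJg, Ne, LinearMap.normDet_eq_zero_iff_ker_ne_bot, not_not]
    exact LinearMap.ker_eq_bot.2 hD
  have hJgpos : 0 < Jg := lt_of_le_of_ne (LinearMap.normDet_nonneg _) (Ne.symm hJg0)
  have hDF : Injective ((L : V →L[ℝ] V').comp D) := L.injective.comp hD
  -- `ξ₀ = σ Jg⁻¹ • D e`, pushed forward along `L`
  obtain ⟨σ, hσ, hξ₀⟩ := frameVector_eq_sign_smul_of_span_eq_range hD e h0 hspan
  have hpush : frameVector (fun i => L (ξ₀ i)) =
      (σ * Jg⁻¹) • frameVector (fun j => ((L : V →L[ℝ] V').comp D) (e j)) := by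
    have := congrArg (Multivector.push (m := m) (L : V →L[ℝ] V')) hξ₀
    rw [Multivector.push_frameVector, map_smul, Multivector.push_frameVector] at this
    exact this
  -- `D' e = JF • GS`, `GS` orthonormal
  have hGS := frameVector_comp_eq_normDet_smul_gramSchmidtNormed hDF e
  have hGSon := orthonormal_gramSchmidtNormed_comp hDF e
  -- compare the norms of `L_* ξ₀`
  have hn1 : ‖frameVector (fun i => L (ξ₀ i))‖ = c := by
    rw [hfv, norm_smul, norm_frameVector_eq_one h1, mul_one, Real.norm_of_nonneg hc.le]
  have hJFnn : 0 ≤ JF := LinearMap.normDet_nonneg _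
  have hn2 : ‖frameVector (fun i => L (ξ₀ i))‖ = Jg⁻¹ * JF := by
    rw [hpush, hGS, ← hJF, smul_smul, norm_smul, norm_frameVector_eq_one hGSon, mul_one, Real.norm_eq_abs,
      abs_mul, abs_mul, abs_inv, abs_of_pos hJgpos, abs_of_nonneg hJFnn]
    rcases hσ with h | h <;> simp [h]
  have h3 : Jg⁻¹ * JF = c := hn2.symm.trans hn1
  calc JF = Jg * (Jg⁻¹ * JF) := by rw [← mul_assoc, mul_inv_cancel₀ hJg0, one_mul]
    _ = Jg * c := by rw [h3]
    _ = c * Jg := mul_comm _ _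

end Frames

section ChangeOfVariables

variable {V : Type*} [NormedAddCommGroup V] [InnerProductSpace ℝ V] [FiniteDimensional ℝ V]
  [MeasurableSpace V] [BorelSpace V]
  {V' : Type*} [NormedAddCommGroup V'] [InnerProductSpace ℝ V'] [FiniteDimensional ℝ V']
  [MeasurableSpace V'] [BorelSpace V'] {m : ℕ}
  {F : Type*} [NormedAddCommGroup F] [NormedSpace ℝ F]

/-- **Change of variables for currents of integration under a linear isomorphism** (Federer 4.1.30 with
3.2.5 and 3.2.20, for the map `L`). Let `(W, θ, ξ)` be admissible rectifiable data on `V`, `L : V ≃ V'` a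
continuous linear isomorphism, and `θ'`, `ξ'` a density and a frame field on `V'` such that for
`𝓗^m ⌞ W`-a.e. `x`: `θ'(L x) = θ(x)`, `ξ'(L x)` is orthonormal, and
`L ξ₁(x) ∧ ⋯ ∧ L ξₘ(x) = c · ξ'₁(L x) ∧ ⋯ ∧ ξ'ₘ(L x)` for some `c > 0` (i.e. `ξ'` is the unit frame of
`L(Tan^m(𝓗^m ⌞ W, x))` oriented like `L_* ξ`). Then for every measurable `A ⊆ W` and every field `ψ` of
`F`-valued `m`-covectors on `V'` (both integrands integrable):
**`∫_{L A} θ'(z) ψ(z)(ξ'(z)) d𝓗^m(z) = ∫_A θ(x) ψ(L x)(L ξ₁(x), …, L ξₘ(x)) d𝓗^m(x)`**, i.e.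
`[L W, θ', ξ'] = L_# [W, θ, ξ]` window by window. Proof: on each bi-Lipschitz piece `gⱼ(Eⱼ)` of the data
(`IsRectifiableData.exists_pieces`) both sides are parameter integrals over `Eⱼ` by the area formula for
`gⱼ` and for `L ∘ gⱼ` (`integral_image_eq_integral_normDet_smul`), with Jacobians `J(Dgⱼ)` and
`J(L ∘ Dgⱼ) = c · J(Dgⱼ)` (`normDet_comp_eq_mul_of_frameVector_eq`). [cite: Federer1969, 4.1.30] -/
theorem setIntegral_image_equiv_eq (L : V ≃L[ℝ] V') {W : Set V} {θ : V → ℤ} {ξ : V → Fin m → V}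
    (hd : IsRectifiableData (⊤ : Opens V) m W θ ξ) {θ' : V' → ℤ} {ξ' : V' → Fin m → V'}
    (hθ : ∀ᵐ x ∂((μHE[m] : Measure V).restrict W), θ' (L x) = θ x)
    (hξ : ∀ᵐ x ∂((μHE[m] : Measure V).restrict W), Orthonormal ℝ (ξ' (L x)) ∧
      ∃ c : ℝ, 0 < c ∧ frameVector (fun i => L (ξ x i)) = c • frameVector (ξ' (L x)))
    {A : Set V} (hA : MeasurableSet A) (hAW : A ⊆ W) (ψ : V' → V' [⋀^Fin m]→L[ℝ] F)
    (hint : IntegrableOn (fun x => (θ x : ℝ) • ψ (L x) (fun i => L (ξ x i))) A (μHE[m] : Measure V))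
    (hint' : IntegrableOn (fun z => (θ' z : ℝ) • ψ z (ξ' z)) ((L : V → V') '' A) (μHE[m] : Measure V')) :
    ∫ z in (L : V → V') '' A, (θ' z : ℝ) • ψ z (ξ' z) ∂(μHE[m] : Measure V') =
      ∫ x in A, (θ x : ℝ) • ψ (L x) (fun i => L (ξ x i)) ∂(μHE[m] : Measure V) := by
  classical
  set μ : Measure V := (μHE[m] : Measure V) with hμ
  set μ' : Measure V' := (μHE[m] : Measure V') with hμ'
  set Φ : V → F := fun x => (θ x : ℝ) • ψ (L x) (fun i => L (ξ x i)) with hΦdef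
  set Φ' : V' → F := fun z => (θ' z : ℝ) • ψ z (ξ' z) with hΦ'def
  have hWm : MeasurableSet W := hd.1
  have hLemb : MeasurableEmbedding (L : V → V') := L.toHomeomorph.measurableEmbedding
  /- Step 1: bi-Lipschitz pieces of the data, cut down to `A`. -/
  obtain ⟨E, g, Lg, Kg, hEm, hgL, hgK, hgd, hgW, hgm, hdisj, hnull, hframe⟩ := hd.exists_pieces
  have hgi : ∀ j, InjOn (g j) (E j) := fun j => injOn_of_antilipschitz_restrict (hgK j)
  let E' : ℕ → Set (EuclideanSpace ℝ (Fin m)) := fun j => E j ∩ g j ⁻¹' A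
  have hE'm : ∀ j, MeasurableSet (E' j) := fun j =>
    (hEm j).inter ((hgL j).continuous.measurable hA)
  have hE'E : ∀ j, E' j ⊆ E j := fun j => inter_subset_left
  have hgd' : ∀ j, ∀ u ∈ E' j, HasFDerivWithinAt (g j) (fderiv ℝ (g j) u) (E' j) u := fun j u hu =>
    (hgd j u hu.1).1.hasFDerivAt.hasFDerivWithinAt
  have hginj' : ∀ j, ∀ u ∈ E' j, Injective (fderiv ℝ (g j) u) := fun j u hu => (hgd j u hu.1).2
  have hgi' : ∀ j, InjOn (g j) (E' j) := fun j => (hgi j).mono (hE'E j)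
  have hgE'm : ∀ j, MeasurableSet (g j '' E' j) := fun j =>
    measurableSet_image_of_hasFDerivWithinAt (hE'm j) (hgd' j) (hgi' j)
  have hgE'A : ∀ j, g j '' E' j ⊆ A := by
    rintro j _ ⟨u, hu, rfl⟩
    exact hu.2
  have hdisj' : Pairwise (Disjoint on fun j => g j '' E' j) := fun j k hjk =>
    (hdisj hjk).mono (image_mono (hE'E j)) (image_mono (hE'E k))
  -- `A` is covered by the cut pieces up to a null set
  have hcovA : A \ (⋃ j, g j '' E' j) ⊆ W \ ⋃ j, g j '' E j := by
    rintro x ⟨hxA, hxU⟩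
    refine ⟨hAW hxA, fun hxU' => hxU ?_⟩
    obtain ⟨j, u, hu, rfl⟩ : ∃ j u, u ∈ E j ∧ g j u = x := by
      obtain ⟨j, hj⟩ := mem_iUnion.1 hxU'
      obtain ⟨u, hu, hux⟩ := hj
      exact ⟨j, u, hu, hux⟩
    exact mem_iUnion.2 ⟨j, u, ⟨hu, hxA⟩, rfl⟩
  have hAae : (⋃ j, g j '' E' j) =ᵐ[μ] A := by
    refine (ae_eq_set).2 ⟨?_, measure_mono_null hcovA hnull⟩
    rw [Set.sdiff_eq_empty.2 (iUnion_subset hgE'A)]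
    exact measure_empty
  /- Step 2: the image pieces `F j '' E' j`, `F j = L ∘ g j`. -/
  set Fj : ℕ → EuclideanSpace ℝ (Fin m) → V' := fun j => (L : V → V') ∘ g j with hFjdef
  set DF : ℕ → EuclideanSpace ℝ (Fin m) → EuclideanSpace ℝ (Fin m) →L[ℝ] V' :=
    fun j u => (L : V →L[ℝ] V').comp (fderiv ℝ (g j) u) with hDFdef
  have hFd : ∀ j, ∀ u ∈ E' j, HasFDerivWithinAt (Fj j) (DF j u) (E' j) u := fun j u hu =>
    ((L : V →L[ℝ] V').hasFDerivAt.comp u (hgd j u hu.1).1.hasFDerivAt).hasFDerivWithinAt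
  have hFinj : ∀ j, ∀ u ∈ E' j, Injective (DF j u) := fun j u hu =>
    L.injective.comp (hgd j u hu.1).2
  have hFi : ∀ j, InjOn (Fj j) (E' j) := fun j => L.injective.injOn.comp (hgi' j) (mapsTo_univ _ _)
  have hFE' : ∀ j, Fj j '' E' j = (L : V → V') '' (g j '' E' j) := fun j => by
    rw [hFjdef, Set.image_comp]
  have hFE'm : ∀ j, MeasurableSet (Fj j '' E' j) := fun j => by
    rw [hFE' j]
    exact hLemb.measurableSet_image.2 (hgE'm j)
  have hFdisj : Pairwise (Disjoint on fun j => Fj j '' E' j) := fun j k hjk => by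
    simp only [onFun, hFE']
    exact (Set.disjoint_image_iff L.injective).2 (hdisj' hjk)
  have hFsub : ∀ j, Fj j '' E' j ⊆ (L : V → V') '' A := fun j => by
    rw [hFE' j]
    exact image_mono (hgE'A j)
  -- `L A` is covered by the image pieces up to a null set
  have hLAae : (⋃ j, Fj j '' E' j) =ᵐ[μ'] (L : V → V') '' A := by
    refine (ae_eq_set).2 ⟨?_, ?_⟩
    · rw [Set.sdiff_eq_empty.2 (iUnion_subset hFsub)]
      exact measure_empty
    · have hset : (L : V → V') '' A \ (⋃ j, Fj j '' E' j) = (L : V → V') '' (A \ ⋃ j, g j '' E' j) := by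
        simp only [hFE', ← Set.image_iUnion, Set.image_sdiff L.injective]
      rw [hset]
      refine nonpos_iff_eq_zero.1 ((((L : V →L[ℝ] V').lipschitz.lipschitzOnWith
        (s := A \ ⋃ j, g j '' E' j)).euclideanHausdorffMeasure_image_le m).trans ?_)
      rw [measure_mono_null hcovA hnull, mul_zero]
  /- Step 3: both integrals are sums over the pieces. -/
  have hsumA : HasSum (fun j => ∫ x in g j '' E' j, Φ x ∂μ) (∫ x in A, Φ x ∂μ) := by
    rw [← setIntegral_congr_set hAae]
    exact hasSum_integral_iUnion hgE'm hdisj' (hint.mono_set (iUnion_subset hgE'A))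
  have hsumLA : HasSum (fun j => ∫ z in Fj j '' E' j, Φ' z ∂μ') (∫ z in (L : V → V') '' A, Φ' z ∂μ') := by
    rw [← setIntegral_congr_set hLAae]
    exact hasSum_integral_iUnion hFE'm hFdisj (hint'.mono_set (iUnion_subset hFsub))
  /- Step 4: on each piece both sides are the same parameter integral. -/
  have hpiece : ∀ j, ∫ z in Fj j '' E' j, Φ' z ∂μ' = ∫ x in g j '' E' j, Φ x ∂μ := by
    intro j
    -- area formula for `g j` and for `F j`
    have h1 := integral_image_eq_integral_normDet_smul (hE'm j) (hgd' j) (hginj' j) (hgi' j) Φ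
    have h2 := integral_image_eq_integral_normDet_smul (hE'm j) (hFd j) (hFinj j) (hFi j) Φ'
    rw [finrank_euclideanSpace_fin] at h1 h2
    rw [h1, h2]
    refine setIntegral_congr_ae (hE'm j) ?_
    -- the a.e. facts at `y = g j u`, transported to the parameters `u ∈ E j`
    have hgdE : ∀ u ∈ E j, HasFDerivWithinAt (g j) (fderiv ℝ (g j) u) (E j) u := fun u hu =>
      (hgd j u hu).1.hasFDerivAt.hasFDerivWithinAt
    have hinjE : ∀ u ∈ E j, Injective (fderiv ℝ (g j) u) := fun u hu => (hgd j u hu).2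
    have hθξ : ∀ᵐ y ∂((μHE[finrank ℝ (EuclideanSpace ℝ (Fin m))] : Measure V).restrict (g j '' E j)),
        (θ' (L y) = θ y ∧ (Orthonormal ℝ (ξ' (L y)) ∧
          ∃ c : ℝ, 0 < c ∧ frameVector (fun i => L (ξ y i)) = c • frameVector (ξ' (L y)))) ∧
        ∀ u ∈ E j, g j u = y → Orthonormal ℝ (ξ y) ∧
          ((Submodule.span ℝ (range (ξ y)) : Set V) = range (fderiv ℝ (g j) u)) := by
      rw [finrank_euclideanSpace_fin]
      exact ((ae_restrict_of_ae_restrict_of_subset (hgW j) hθ).and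
        (ae_restrict_of_ae_restrict_of_subset (hgW j) hξ)).and (hframe j)
    have hu := ae_restrict_comp_of_ae_restrict_image (hEm j) hgdE hinjE (hgi j) hθξ
    rw [ae_restrict_iff' (hEm j)] at hu
    filter_upwards [hu] with u hu huE'
    obtain ⟨⟨hθu, hon1, c, hc, hfv⟩, hfr⟩ := hu (hE'E j huE')
    obtain ⟨hon0, hspan⟩ := hfr u (hE'E j huE') rfl
    -- Jacobians: `J(L ∘ Dg) = c · J(Dg)`
    have hJ := normDet_comp_eq_mul_of_frameVector_eq (EuclideanSpace.basisFun (Fin m) ℝ)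
      (hgd j u (hE'E j huE')).2 hon0 hspan L hon1 hc hfv
    -- the covector identity `ψ(L ξ₀) = c • ψ(ξ₁)`
    have hψ := apply_eq_smul_of_frameVector_eq hfv (ψ (L (g j u)))
    simp only [hΦdef, hΦ'def, hFjdef, hDFdef, Function.comp_apply, hθu, hψ, hJ, smul_smul]
    congr 1
    ring
  /- Step 5: assemble. -/
  rw [← hsumLA.tsum_eq, ← hsumA.tsum_eq]
  exact tsum_congr hpiece

end ChangeOfVariables

end Literature.Geometry.GeometricMeasureTheory
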